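import Mathlib
import Summits.NavierStokesRegularity.Statement
import Literature.Analysis.FluidPDE.ClassicalSolution
import Literature.Analysis.FluidPDE.LerayHopf
import Literature.Analysis.FluidPDE.SuitableWeak
import Literature.Analysis.FluidPDE.LocalTypeI
import Literature.Analysis.FluidPDE.CKN1982Setting
import Literature.Analysis.FluidPDE.ClassicalSuitable
import Literature.Analysis.FluidPDE.NSViscosityRescaling
import Literature.Analysis.FluidPDE.NSLerayHopfABCScaling
import Literature.Analysis.FluidPDE.PressureDecayEstimate
import Literature.Analysis.FluidPDE.PressureDecayEstimateProofs
import Literature.Analysis.FluidPDE.ClassicalTopPointCubic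
import Literature.Analysis.FluidPDE.BesovBlowupConcentration
import Literature.Analysis.FluidPDE.LerayHopfSpatialGradient
import Literature.Analysis.FluidPDE.NSSuitableESSProofs
import Literature.Analysis.FluidPDE.Seregin2020ScaledEnergyBounds
import Summits.NavierStokesRegularity.NavierStokesRegularity.Theses.RootDecompLitSlice
import Summits.NavierStokesRegularity.NavierStokesRegularity.Theses.RootDecompMorreyBudget
import Summits.NavierStokesRegularity.NavierStokesRegularity.Theses.EulerZoomLiouville
import Summits.NavierStokesRegularity.NavierStokesRegularity.Theses.RootDecompStaticSkirt
import Summits.NavierStokesRegularity.NavierStokesRegularity.Theorems.EulerZoomLiouvilleSereginZoomReduction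
import Summits.NavierStokesRegularity.NavierStokesRegularity.Theorems.QuarterJoltNoTerminalJoltPosition
import Summits.NavierStokesRegularity.NavierStokesRegularity.Theorems.RootDecompStaticSkirtEngineKillsConicalJolt
import Summits.NavierStokesRegularity.NavierStokesRegularity.Theorems.RootDecompStaticSkirtJoltingCells
import Summits.NavierStokesRegularity.NavierStokesRegularity.Theorems.RootDecompStaticSkirtOnsagerLadder
import Summits.NavierStokesRegularity.NavierStokesRegularity.Theorems.RootDecompStaticSkirtVelocityClock

/-!
# N25 «THE STATIC SKIRT» · ONSAGER EDGE — K11 «THE CONE SETS THE ENSTROPHY CLOCK»: RZ ⟹ EE ⟹ NA (PROVED rung)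

Lens-6 g16 kernel K11 (critic row 163 booking (3)): near a tame-conical jolting skirt vertex, the two-regime ENSTROPHY
CLOCK `∫_{B_ρ(x₀)} |∇u(t)|² ≤ K · min(ρ³ (ν(T−t))^{−2}, (ν(T−t))^{(1−2a)/(1+a)})` (aside RZ `EnstrophyClockedSkirt` of the
child route `RootDecompOnsagerEdge`) gives the laminar DISSIPATION GAUGE EE of the normalised solution (Tonelli + two time
regimes split at `σ* = r^{1+a}`), hence — by K9a of `Theorems/RootDecompStaticSkirtOnsagerLadder.lean` — the crux NA
`ConicalSkirtNoAnomaly`.  RZ and NA are written as their VERBATIM ledger signatures; EE is spelled inline.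

Sources: CKN 1982 §2; Duchon–Robert 2000; Drivas–Eyink 2019 (arXiv:1710.05205); lens file
HOME/decomp-ns-lens-6/OnsagerEdge.lean §18b (K11).
-/

noncomputable section

set_option linter.dupNamespace false

namespace Summit.NavierStokesRegularity.NavierStokesRegularity.Theorems.RootDecompStaticSkirtEnstrophyClock

open Summit.NavierStokesRegularity.NavierStokesRegularity.Theses
open Summit.NavierStokesRegularity.NavierStokesRegularity.Theorems.RootDecompStaticSkirtOnsagerLadder
  (noAnomaly_of_dissipationGauge)
open Summit.NavierStokesRegularity.NavierStokesRegularity.Theorems.RootDecompStaticSkirtVelocityClock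
  (early_time_integral late_time_integral)
open scoped Topology ENNReal NNReal InnerProductSpace RealInnerProductSpace
open Filter Set MeasureTheory Metric Function
open Literature.Analysis.FluidPDE

/-! ## K11 · enstrophy clock ⟹ dissipation gauge ⟹ no anomaly -/

/-- continuity of the Frobenius norm squared (local copy of the tree's `continuous_frobeniusNormSq'`). -/
private theorem continuous_frobeniusNormSq_loc :
    Continuous fun L : EuclideanSpace ℝ (Fin 3) →L[ℝ] EuclideanSpace ℝ (Fin 3) => frobeniusNormSq L := by
  unfold frobeniusNormSq
  exact continuous_finsetSum _ fun i _ =>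
    ((ContinuousLinearMap.apply ℝ (EuclideanSpace ℝ (Fin 3)) _).continuous.norm).pow 2

/-- **K11 · «THE CONE SETS THE ENSTROPHY CLOCK»: enstrophy clock ⟹ dissipation gauge.** If near the vertex the local
enstrophy obeys the two-regime collapse clock of RZ, then the normalised solution `v = ν⁻¹u(·/ν)` obeys the laminar
dissipation gauge `r^{a−1} E(r; ∇v, νT, x₀) ≤ M` for small `r`. -/
theorem dissipationGauge_of_enstrophyClock {ν T : ℝ} (hν : 0 < ν) (hT : 0 < T)
    {u : ℝ → EuclideanSpace ℝ (Fin 3) → EuclideanSpace ℝ (Fin 3)} {p : ℝ → EuclideanSpace ℝ (Fin 3) → ℝ}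
    (hmax : IsMaximalSmoothSolution ν 0 u p T)
    {x₀ : EuclideanSpace ℝ (Fin 3)} {a K r₂ : ℝ} (ha1 : 1 < a) (ha2 : a ≤ 3 / 2) (hK : 0 ≤ K) (hr₂ : 0 < r₂)
    (hZ : ∀ ρ ∈ Set.Ioc 0 r₂, ∀ t ∈ Set.Ioo (T - r₂ ^ 2) T,
      ∫⁻ x in ball x₀ ρ, ENNReal.ofReal (frobeniusNormSq (fderiv ℝ (u t) x)) ≤
        ENNReal.ofReal (K * min (ρ ^ 3 * (ν * (T - t)) ^ (-(2 : ℝ))) ((ν * (T - t)) ^ ((1 - 2 * a) / (1 + a))))) :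
    ∃ (r₁ : ℝ) (M : NNReal), 0 < r₁ ∧ ∀ r' ∈ Set.Ioc 0 r₁,
      ENNReal.ofReal (r' ^ (a - 1)) * cknE r' (ν * T, x₀) (fun s y => fderiv ℝ ((fun s y => ν⁻¹ • u (s / ν) y) s) y) ≤ M := by
  set vNu : ℝ → EuclideanSpace ℝ (Fin 3) → EuclideanSpace ℝ (Fin 3) := fun s y => ν⁻¹ • u (s / ν) y
    with hvNu_def
  -- exponents: the core regime `(d − s)^{e}`, `e = (1 − 2a)/(1 + a) ∈ (−1, 0)`, `β := −e`
  have h1a : 0 < 1 + a := by linarith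
  set β : ℝ := (2 * a - 1) / (1 + a) with hβdef
  have hβ1 : β < 1 := by rw [hβdef, div_lt_one h1a]; linarith
  have hβ0 : 0 < β := div_pos (by linarith) h1a
  have hβe : -β = (1 - 2 * a) / (1 + a) := by rw [hβdef, ← neg_div]; congr 1; ring
  have hβa : (1 + a) * (1 - β) = 2 - a := by
    rw [hβdef]; field_simp; ring
  have hν0 : ν ≠ 0 := hν.ne'
  -- smoothness: the slice gradient is jointly continuous on `[0,T) × ℝ³`
  have hC1 : ContDiffOn ℝ 1 (uncurry u) (Set.Ico 0 T ×ˢ univ) :=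
    hmax.1.smooth_velocity.of_le (by exact_mod_cast le_top)
  have hcontG : ContinuousOn (fun q : ℝ × EuclideanSpace ℝ (Fin 3) => fderiv ℝ (u q.1) q.2) (Set.Ico 0 T ×ˢ univ) :=
    continuousOn_fderiv_slice_of_contDiffOn hC1 (uniqueDiffOn_Ico 0 T)
  -- the radius
  have hνm : 0 < ν * min (r₂ ^ 2) T := mul_pos hν (lt_min (pow_pos hr₂ 2) hT)
  set r₁ : ℝ := min (min r₂ 1) (Real.sqrt (ν * min (r₂ ^ 2) T)) with hr₁def
  have hr₁ : 0 < r₁ := lt_min (lt_min hr₂ one_pos) (Real.sqrt_pos.2 hνm)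
  have hr₁r₂ : r₁ ≤ r₂ := (min_le_left _ _).trans (min_le_left _ _)
  have hr₁1 : r₁ ≤ 1 := (min_le_left _ _).trans (min_le_right _ _)
  have hr₁sq : r₁ ^ 2 ≤ ν * min (r₂ ^ 2) T := by
    have h1 : r₁ ≤ Real.sqrt (ν * min (r₂ ^ 2) T) := min_le_right _ _
    calc r₁ ^ 2 ≤ Real.sqrt (ν * min (r₂ ^ 2) T) ^ 2 := pow_le_pow_left₀ hr₁.le h1 2
      _ = ν * min (r₂ ^ 2) T := Real.sq_sqrt hνm.le
  have hr₁ν2 : r₁ ^ 2 ≤ ν * r₂ ^ 2 := hr₁sq.trans (mul_le_mul_of_nonneg_left (min_le_left _ _) hν.le)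
  have hr₁νT : r₁ ^ 2 ≤ ν * T := hr₁sq.trans (mul_le_mul_of_nonneg_left (min_le_right _ _) hν.le)
  -- the constant
  set κ : ℝ := ν⁻¹ ^ 2 * K with hκdef
  have hκ : 0 ≤ κ := mul_nonneg (pow_nonneg (inv_pos.2 hν).le 2) hK
  set Mtot : ℝ≥0∞ := ENNReal.ofReal (κ * (1 + 1 / (1 - β))) with hMdef
  have hMtop : Mtot ≠ ⊤ := ENNReal.ofReal_ne_top
  refine ⟨r₁, Mtot.toNNReal, hr₁, fun r' hr' => ?_⟩
  rw [ENNReal.coe_toNNReal hMtop]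
  have hR0 : 0 < r' := hr'.1
  have hR1 : r' ≤ 1 := hr'.2.trans hr₁1
  have hRr₂ : r' ≤ r₂ := hr'.2.trans hr₁r₂
  have hRsq : r' ^ 2 ≤ r₁ ^ 2 := pow_le_pow_left₀ hR0.le hr'.2 2
  have hRν2 : r' ^ 2 ≤ ν * r₂ ^ 2 := hRsq.trans hr₁ν2
  have hRνT : r' ^ 2 ≤ ν * T := hRsq.trans hr₁νT
  -- the split time σ* = r'^{1+a} ≤ r'^2
  set σs : ℝ := r' ^ (1 + a) with hσsdef
  have hσs : 0 < σs := Real.rpow_pos_of_pos hR0 _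
  have hσs2 : σs ≤ r' ^ 2 := by
    rw [hσsdef, ← Real.rpow_natCast r' 2]
    exact Real.rpow_le_rpow_of_exponent_ge hR0 hR1 (by push_cast; linarith)
  -- the window
  set d : ℝ := ν * T with hddef
  set A : ℝ := d - r' ^ 2 with hAdef
  set m : ℝ := d - σs with hmdef
  have hAm : A ≤ m := by rw [hAdef, hmdef]; linarith
  have hmd : m < d := by rw [hmdef]; linarith
  have hA0 : 0 ≤ A := by rw [hAdef, hddef]; linarith
  have hdm : d - m = σs := by rw [hmdef]; ring
  -- normalised time ↦ physical time
  have hwin : ∀ s ∈ Set.Ioo A d, s / ν ∈ Set.Ioo (T - r₂ ^ 2) T ∧ s / ν ∈ Set.Ico 0 T ∧ ν * (T - s / ν) = d - s := by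
    intro s hs
    have hsA : A < s := hs.1
    have hsd : s < d := hs.2
    rw [hAdef, hddef] at hsA
    rw [hddef] at hsd
    refine ⟨⟨?_, ?_⟩, ⟨div_nonneg (hA0.trans hs.1.le) hν.le, ?_⟩, ?_⟩
    · rw [lt_div_iff₀ hν]; nlinarith [hsA, hRν2]
    · rw [div_lt_iff₀ hν]; linarith [hsd]
    · rw [div_lt_iff₀ hν]; linarith [hsd]
    · rw [hddef]; field_simp
  -- the integrand of `E` in the normalised variables, pointwise on the window × ball
  have hGeq : Set.EqOn
      (fun w : ℝ × EuclideanSpace ℝ (Fin 3) => ENNReal.ofReal (frobeniusNormSq (fderiv ℝ (vNu w.1) w.2)))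
      (fun w => ENNReal.ofReal (ν⁻¹ ^ 2 * frobeniusNormSq (fderiv ℝ (u (w.1 / ν)) w.2)))
      (Set.Ioo A d ×ˢ ball x₀ r') := by
    intro w hw
    have ht : w.1 / ν ∈ Set.Ico 0 T := (hwin w.1 hw.1).2.1
    have hdiff : DifferentiableAt ℝ (u (w.1 / ν)) w.2 :=
      ((contDiff_slice_of_contDiffOn hC1 ht).differentiable one_ne_zero) w.2
    show ENNReal.ofReal (frobeniusNormSq (fderiv ℝ (fun y => ν⁻¹ • u (w.1 / ν) y) w.2)) =
      ENNReal.ofReal (ν⁻¹ ^ 2 * frobeniusNormSq (fderiv ℝ (u (w.1 / ν)) w.2))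
    rw [fderiv_fun_const_smul hdiff, frobeniusNormSq_const_smul]
  -- Tonelli on the window × ball
  have hg : Continuous (fun w : ℝ × EuclideanSpace ℝ (Fin 3) => (w.1 / ν, w.2)) := by fun_prop
  have hmaps : Set.MapsTo (fun w : ℝ × EuclideanSpace ℝ (Fin 3) => (w.1 / ν, w.2))
      (Set.Ioo A d ×ˢ ball x₀ r') (Set.Ico 0 T ×ˢ univ) := fun w hw => ⟨(hwin w.1 hw.1).2.1, trivial⟩
  have hc' : ContinuousOn
      (fun w : ℝ × EuclideanSpace ℝ (Fin 3) => ν⁻¹ ^ 2 * frobeniusNormSq (fderiv ℝ (u (w.1 / ν)) w.2))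
      (Set.Ioo A d ×ˢ ball x₀ r') :=
    continuousOn_const.mul (continuous_frobeniusNormSq_loc.comp_continuousOn (hcontG.comp hg.continuousOn hmaps))
  have hmeasW : AEMeasurable
      (fun w : ℝ × EuclideanSpace ℝ (Fin 3) => ENNReal.ofReal (ν⁻¹ ^ 2 * frobeniusNormSq (fderiv ℝ (u (w.1 / ν)) w.2)))
      ((volume.restrict (Set.Ioo A d)).prod (volume.restrict (ball x₀ r'))) := by
    rw [Measure.prod_restrict, ← Measure.volume_eq_prod]
    exact (hc'.aestronglyMeasurable (measurableSet_Ioo.prod measurableSet_ball)).aemeasurable.ennreal_ofReal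
  have hY : ∫⁻ w in parabolicCylinder r' (d, x₀), ENNReal.ofReal (frobeniusNormSq (fderiv ℝ (vNu w.1) w.2)) =
      ∫⁻ s in Set.Ioo A d, ∫⁻ y in ball x₀ r', ENNReal.ofReal (ν⁻¹ ^ 2 * frobeniusNormSq (fderiv ℝ (u (s / ν)) y)) := by
    have h1 : ∫⁻ w in parabolicCylinder r' (d, x₀), ENNReal.ofReal (frobeniusNormSq (fderiv ℝ (vNu w.1) w.2)) =
        ∫⁻ w in Set.Ioo A d ×ˢ ball x₀ r',
          ENNReal.ofReal (ν⁻¹ ^ 2 * frobeniusNormSq (fderiv ℝ (u (w.1 / ν)) w.2)) :=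
      setLIntegral_congr_fun (measurableSet_Ioo.prod measurableSet_ball) hGeq
    rw [h1, Measure.volume_eq_prod, ← Measure.prod_restrict]
    exact lintegral_prod _ hmeasW
  -- slice bound: pull the constant and apply the clock at physical time s/ν
  have hslice : ∀ s ∈ Set.Ioo A d,
      ∫⁻ y in ball x₀ r', ENNReal.ofReal (ν⁻¹ ^ 2 * frobeniusNormSq (fderiv ℝ (u (s / ν)) y)) ≤
        ENNReal.ofReal (κ * min (r' ^ 3 * (d - s) ^ (-(2 : ℝ))) ((d - s) ^ (-β))) := by
    intro s hs
    obtain ⟨hts, -, hνs⟩ := hwin s hs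
    have hpull : ∫⁻ y in ball x₀ r', ENNReal.ofReal (ν⁻¹ ^ 2 * frobeniusNormSq (fderiv ℝ (u (s / ν)) y)) =
        ENNReal.ofReal (ν⁻¹ ^ 2) * ∫⁻ y in ball x₀ r', ENNReal.ofReal (frobeniusNormSq (fderiv ℝ (u (s / ν)) y)) := by
      rw [← lintegral_const_mul' _ _ ENNReal.ofReal_ne_top]
      refine lintegral_congr fun y => ?_
      rw [ENNReal.ofReal_mul (by positivity)]
    have hz := hZ r' ⟨hR0, hRr₂⟩ (s / ν) hts
    rw [hνs, ← hβe] at hz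
    rw [hpull, hκdef, mul_assoc, ENNReal.ofReal_mul (by positivity : (0 : ℝ) ≤ ν⁻¹ ^ 2)]
    exact mul_le_mul' le_rfl hz
  -- EARLY regime `s ∈ (A, m]`: the ball regime `κ r'^3 (d − s)^{−2}`
  have hIe : IntegrableOn (fun s => κ * r' ^ 3 * (d - s) ^ (-(2 : ℝ))) (Set.Ioc A m) volume := by
    have hc : ContinuousOn (fun s => κ * r' ^ 3 * (d - s) ^ (-(2 : ℝ))) (Set.Icc A m) := by
      refine continuousOn_const.mul ((continuousOn_const.sub continuousOn_id).rpow_const ?_)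
      intro x hx
      left
      show d - x ≠ 0
      exact ne_of_gt (by linarith [hx.2, hmd])
    exact hc.integrableOn_Icc.mono_set Set.Ioc_subset_Icc_self
  have hnnE : 0 ≤ᵐ[volume.restrict (Set.Ioc A m)] fun s => κ * r' ^ 3 * (d - s) ^ (-(2 : ℝ)) :=
    (ae_restrict_iff' measurableSet_Ioc).2 (Eventually.of_forall fun s hs =>
      mul_nonneg (mul_nonneg hκ (pow_nonneg hR0.le 3)) (Real.rpow_nonneg (by linarith [hs.2]) _))
  have hrealE : ∫ s in Set.Ioc A m, κ * r' ^ 3 * (d - s) ^ (-(2 : ℝ)) ≤ κ * r' ^ 3 * σs ^ (-(1 : ℝ)) := by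
    rw [integral_const_mul, ← intervalIntegral.integral_of_le hAm]
    have h := early_time_integral (γ := 2) (by norm_num) hAm hmd
    rw [hdm, show (1 : ℝ) - 2 = -1 by norm_num, show (2 : ℝ) - 1 = 1 by norm_num, div_one] at h
    exact mul_le_mul_of_nonneg_left h (mul_nonneg hκ (pow_nonneg hR0.le 3))
  have hEarly : ∫⁻ s in Set.Ioc A m, ∫⁻ y in ball x₀ r',
      ENNReal.ofReal (ν⁻¹ ^ 2 * frobeniusNormSq (fderiv ℝ (u (s / ν)) y)) ≤
      ENNReal.ofReal (κ * r' ^ 3 * σs ^ (-(1 : ℝ))) := by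
    calc ∫⁻ s in Set.Ioc A m, ∫⁻ y in ball x₀ r', ENNReal.ofReal (ν⁻¹ ^ 2 * frobeniusNormSq (fderiv ℝ (u (s / ν)) y))
        ≤ ∫⁻ s in Set.Ioc A m, ENNReal.ofReal (κ * r' ^ 3 * (d - s) ^ (-(2 : ℝ))) :=
          setLIntegral_mono' measurableSet_Ioc fun s hs => by
            refine (hslice s ⟨hs.1, lt_of_le_of_lt hs.2 hmd⟩).trans (ENNReal.ofReal_le_ofReal ?_)
            calc κ * min (r' ^ 3 * (d - s) ^ (-(2 : ℝ))) ((d - s) ^ (-β))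
                ≤ κ * (r' ^ 3 * (d - s) ^ (-(2 : ℝ))) := mul_le_mul_of_nonneg_left (min_le_left _ _) hκ
              _ = κ * r' ^ 3 * (d - s) ^ (-(2 : ℝ)) := (mul_assoc _ _ _).symm
      _ = ENNReal.ofReal (∫ s in Set.Ioc A m, κ * r' ^ 3 * (d - s) ^ (-(2 : ℝ))) := by
          rw [← ofReal_integral_eq_lintegral_ofReal hIe hnnE]
      _ ≤ ENNReal.ofReal (κ * r' ^ 3 * σs ^ (-(1 : ℝ))) := ENNReal.ofReal_le_ofReal hrealE
  -- LATE regime `s ∈ (m, d)`: the core regime `κ (d − s)^{−β}`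
  have hIl : IntegrableOn (fun s => κ * (d - s) ^ (-β)) (Set.Ioo m d) volume := by
    have h1 : IntervalIntegrable (fun x : ℝ => x ^ (-β)) volume 0 σs :=
      intervalIntegral.intervalIntegrable_rpow' (by linarith)
    have h2 := (h1.comp_sub_left d).symm
    rw [sub_zero] at h2
    have h3 : IntegrableOn (fun x => (d - x) ^ (-β)) (Set.Ioo m d) volume := by
      rw [hmdef]
      exact (intervalIntegrable_iff_integrableOn_Ioo_of_le (by linarith)).1 h2
    exact h3.const_mul κ
  have hnnL : 0 ≤ᵐ[volume.restrict (Set.Ioo m d)] fun s => κ * (d - s) ^ (-β) :=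
    (ae_restrict_iff' measurableSet_Ioo).2 (Eventually.of_forall fun s hs =>
      mul_nonneg hκ (Real.rpow_nonneg (by linarith [hs.2]) _))
  have hrealL : ∫ s in Set.Ioo m d, κ * (d - s) ^ (-β) = κ * (σs ^ (1 - β) / (1 - β)) := by
    rw [integral_const_mul, ← integral_Ioc_eq_integral_Ioo, ← intervalIntegral.integral_of_le hmd.le, hmdef,
      late_time_integral hβ1 hσs.le]
  have hLate : ∫⁻ s in Set.Ioo m d, ∫⁻ y in ball x₀ r',
      ENNReal.ofReal (ν⁻¹ ^ 2 * frobeniusNormSq (fderiv ℝ (u (s / ν)) y)) ≤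
      ENNReal.ofReal (κ * (σs ^ (1 - β) / (1 - β))) := by
    calc ∫⁻ s in Set.Ioo m d, ∫⁻ y in ball x₀ r', ENNReal.ofReal (ν⁻¹ ^ 2 * frobeniusNormSq (fderiv ℝ (u (s / ν)) y))
        ≤ ∫⁻ s in Set.Ioo m d, ENNReal.ofReal (κ * (d - s) ^ (-β)) :=
          setLIntegral_mono' measurableSet_Ioo fun s hs => by
            refine (hslice s ⟨lt_of_le_of_lt hAm hs.1, hs.2⟩).trans (ENNReal.ofReal_le_ofReal ?_)
            exact mul_le_mul_of_nonneg_left (min_le_right _ _) hκ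
      _ = ENNReal.ofReal (∫ s in Set.Ioo m d, κ * (d - s) ^ (-β)) := by
          rw [← ofReal_integral_eq_lintegral_ofReal hIl hnnL]
      _ = ENNReal.ofReal (κ * (σs ^ (1 - β) / (1 - β))) := by rw [hrealL]
  -- exponent bookkeeping: both regimes give r'^{2−a}
  have hσ1 : r' ^ 3 * σs ^ (-(1 : ℝ)) = r' ^ (2 - a) := by
    rw [hσsdef, ← Real.rpow_mul hR0.le, ← Real.rpow_natCast r' 3, ← Real.rpow_add hR0]
    congr 1; push_cast; ring
  have hσ2 : σs ^ (1 - β) = r' ^ (2 - a) := by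
    rw [hσsdef, ← Real.rpow_mul hR0.le, hβa]
  have hsplit : Set.Ioo A d = Set.Ioc A m ∪ Set.Ioo m d := (Set.Ioc_union_Ioo_eq_Ioo hAm hmd).symm
  have hQ : ∫⁻ w in parabolicCylinder r' (d, x₀), ENNReal.ofReal (frobeniusNormSq (fderiv ℝ (vNu w.1) w.2)) ≤
      ENNReal.ofReal (r' ^ (2 - a)) * Mtot := by
    rw [hY, hsplit]
    refine (lintegral_union_le _ _ _).trans ((add_le_add hEarly hLate).trans (le_of_eq ?_))
    rw [mul_assoc κ, hσ1, hσ2, hMdef, ← ENNReal.ofReal_mul (Real.rpow_nonneg hR0.le _),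
      ← ENNReal.ofReal_add (mul_nonneg hκ (Real.rpow_nonneg hR0.le _))
        (mul_nonneg hκ (div_nonneg (Real.rpow_nonneg hR0.le _) (by linarith)))]
    congr 1
    have h1β : (1 : ℝ) - β ≠ 0 := by linarith
    field_simp
  -- the dissipation gauge
  show ENNReal.ofReal (r' ^ (a - 1)) * cknE r' (d, x₀) (fun s y => fderiv ℝ (vNu s) y) ≤ Mtot
  unfold cknE
  calc ENNReal.ofReal (r' ^ (a - 1)) *
        ((ENNReal.ofReal r')⁻¹ *
          ∫⁻ w in parabolicCylinder r' (d, x₀), ENNReal.ofReal (frobeniusNormSq (fderiv ℝ (vNu w.1) w.2)))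
      ≤ ENNReal.ofReal (r' ^ (a - 1)) * ((ENNReal.ofReal r')⁻¹ * (ENNReal.ofReal (r' ^ (2 - a)) * Mtot)) := by
        gcongr
    _ = Mtot := by
        rw [← ENNReal.ofReal_inv_of_pos hR0, ← mul_assoc, ← mul_assoc,
          ← ENNReal.ofReal_mul (Real.rpow_nonneg hR0.le _), ← ENNReal.ofReal_mul (by positivity)]
        have h1 : r' ^ (a - 1) * r'⁻¹ * r' ^ (2 - a) = 1 := by
          rw [← Real.rpow_neg_one, ← Real.rpow_add hR0, ← Real.rpow_add hR0,
            show (a - 1) + -1 + (2 - a) = 0 by ring, Real.rpow_zero]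
        rw [h1, ENNReal.ofReal_one, one_mul]

/-- **K11 corollary · RZ ⟹ EE.** The enstrophy-clock attack signature implies the dissipation gauge EE
`ConicalSkirtDissipationGauge` (spelled inline; EE ⟺ NA ∧ QL is not a booked item) outright. -/
theorem conicalSkirtDissipationGauge_of_enstrophyClockedSkirt
    (hRZ : ∀ (ν T : ℝ), 0 < ν → 0 < T → ∀ (u : ℝ → EuclideanSpace ℝ (Fin 3) → EuclideanSpace ℝ (Fin 3)) (p : ℝ → EuclideanSpace ℝ (Fin 3) → ℝ), Literature.Analysis.FluidPDE.IsMaximalSmoothSolution ν 0 u p T → Literature.Analysis.FluidPDE.IsLerayHopfOn T ν 0 (u 0) u → Literature.Analysis.FluidPDE.HasRapidSpatialDecay (u 0) → Filter.Tendsto (fun t => MeasureTheory.eLpNorm (u t - u T) 2 MeasureTheory.volume) (nhdsWithin T (Set.Iio T)) (nhds 0) → ∀ (x₀ : EuclideanSpace ℝ (Fin 3)) (r : ℕ → ℝ) (a r₀ C J c η : ℝ), ((∀ k, 0 < r k) ∧ Filter.Tendsto r Filter.atTop (nhds 0) ∧ Filter.Tendsto (fun k => (r k)⁻¹ * ∫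 x in Metric.ball x₀ (r k), ‖u T x‖ ^ 2) Filter.atTop Filter.atTop) → (∃ c : ℝ, 0 < c ∧ ∀ k, ∃ t ∈ Set.Ioo (T - r k ^ 2) T, c * (∫ x in Metric.ball x₀ (r k), ‖u T x‖ ^ 2) < ∫ x in Metric.ball x₀ (r k), ‖u t x - u T x‖ ^ 2) → 1 < a → a ≤ 3 / 2 → 0 < r₀ → 0 ≤ C → 0 ≤ J → 0 < c → 0 < η → (∀ ρ ∈ Set.Ioc 0 r₀, (∫⁻ x in Metric.ball x₀ ρ, ‖u T x‖ₑ ^ 2 ≤ ENNReal.ofReal (C * ρ ^ (3 - 2 * a))) ∧ ∀ s ∈ Set.Ioo (T - ρ ^ 2 / ν) T, ∫⁻ x in Metric.ball x₀ ρ, ‖u s x - u T x‖ₑ ^ 2 ≤ ENNReal.ofReal J * ∫⁻ x in Metric.ball x₀ ρ, ‖u T x‖ₑ ^ 2) → (∀ k : ℕ, ENNReal.ofReal (c * r k ^ (3 - 2 * a)) ≤ ∫⁻ x in Metric.ball x₀ (r k), ‖u T x‖ₑ ^ 2 ∧ ∀ s ∈ Set.Ioo (T - r k ^ (1 + a) /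 ν) T, ENNReal.ofReal η * ∫⁻ x in Metric.ball x₀ (r k), ‖u T x‖ₑ ^ 2 ≤ ∫⁻ x in Metric.ball x₀ (r k), ‖u s x‖ₑ ^ 2) → ∃ (K r₂ : ℝ), 0 < r₂ ∧ ∀ ρ ∈ Set.Ioc 0 r₂, ∀ t ∈ Set.Ioo (T - r₂ ^ 2) T, ∫⁻ x in Metric.ball x₀ ρ, ENNReal.ofReal (Literature.Analysis.FluidPDE.frobeniusNormSq (fderiv ℝ (u t) x)) ≤ ENNReal.ofReal (K * min (ρ ^ 3 * (ν * (T - t)) ^ (-(2 : ℝ))) ((ν * (T - t)) ^ ((1 - 2 * a) / (1 + a))))) :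
    ∀ (ν T : ℝ), 0 < ν → 0 < T → ∀ (u : ℝ → EuclideanSpace ℝ (Fin 3) → EuclideanSpace ℝ (Fin 3)) (p : ℝ → EuclideanSpace ℝ (Fin 3) → ℝ), Literature.Analysis.FluidPDE.IsMaximalSmoothSolution ν 0 u p T → Literature.Analysis.FluidPDE.IsLerayHopfOn T ν 0 (u 0) u → Literature.Analysis.FluidPDE.HasRapidSpatialDecay (u 0) → Filter.Tendsto (fun t => MeasureTheory.eLpNorm (u t - u T) 2 MeasureTheory.volume) (nhdsWithin T (Set.Iio T)) (nhds 0) → ∀ (x₀ : EuclideanSpace ℝ (Fin 3)) (r : ℕ → ℝ) (a r₀ C J c η : ℝ), ((∀ k, 0 < r k) ∧ Filter.Tendsto r Filter.atTop (nhds 0) ∧ Filter.Tendsto (fun k => (r k)⁻¹ * ∫ x in Metric.ball x₀ (r k), ‖u T x‖ ^ 2) Filter.atTop Filter.atTop) → (∃ c : ℝ, 0 < c ∧ ∀ k, ∃ t ∈ Set.Ioo (T - r k ^ 2) T, c * (∫ x in Metric.ball x₀ (r k), ‖u T x‖ ^ 2) < ∫ x in Metric.ball x₀ (r k), ‖u t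 x - u T x‖ ^ 2) → 1 < a → a ≤ 3 / 2 → 0 < r₀ → 0 ≤ C → 0 ≤ J → 0 < c → 0 < η → (∀ ρ ∈ Set.Ioc 0 r₀, (∫⁻ x in Metric.ball x₀ ρ, ‖u T x‖ₑ ^ 2 ≤ ENNReal.ofReal (C * ρ ^ (3 - 2 * a))) ∧ ∀ s ∈ Set.Ioo (T - ρ ^ 2 / ν) T, ∫⁻ x in Metric.ball x₀ ρ, ‖u s x - u T x‖ₑ ^ 2 ≤ ENNReal.ofReal J * ∫⁻ x in Metric.ball x₀ ρ, ‖u T x‖ₑ ^ 2) → (∀ k : ℕ, ENNReal.ofReal (c * r k ^ (3 - 2 * a)) ≤ ∫⁻ x in Metric.ball x₀ (r k), ‖u T x‖ₑ ^ 2 ∧ ∀ s ∈ Set.Ioo (T - r k ^ (1 + a) / ν) T, ENNReal.ofReal η * ∫⁻ x in Metric.ball x₀ (r k), ‖u T x‖ₑ ^ 2 ≤ ∫⁻ x in Metric.ball x₀ (r k), ‖u s x‖ₑ ^ 2) → ∃ (r₁ : ℝ) (M : NNReal), 0 < r₁ ∧ ∀ r' ∈ Set.Ioc 0 r₁, ENNReal.ofReal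 (r' ^ (a - 1)) * Literature.Analysis.FluidPDE.cknE r' (ν * T, x₀) (fun s y => fderiv ℝ (fun y => ν⁻¹ • u (s / ν) y) y) ≤ (M : ENNReal) := by
  intro ν T hν hT u p hmax hLH hdec htend x₀ r a r₀ C J c η hs hj ha1 ha2 hr₀ hC hJ hc hη htemp hfloor
  obtain ⟨K, r₂, hr₂, hclock⟩ :=
    hRZ ν T hν hT u p hmax hLH hdec htend x₀ r a r₀ C J c η hs hj ha1 ha2 hr₀ hC hJ hc hη htemp hfloor
  have hclock' : ∀ ρ ∈ Set.Ioc 0 r₂, ∀ t ∈ Set.Ioo (T - r₂ ^ 2) T,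
      ∫⁻ x in ball x₀ ρ, ENNReal.ofReal (frobeniusNormSq (fderiv ℝ (u t) x)) ≤
        ENNReal.ofReal (max K 0 * min (ρ ^ 3 * (ν * (T - t)) ^ (-(2 : ℝ))) ((ν * (T - t)) ^ ((1 - 2 * a) / (1 + a)))) :=
    fun ρ hρ t ht => (hclock ρ hρ t ht).trans (ENNReal.ofReal_le_ofReal
      (mul_le_mul_of_nonneg_right (le_max_left _ _) (le_min (mul_nonneg (pow_nonneg hρ.1.le 3)
        (Real.rpow_nonneg (by nlinarith [ht.2]) _)) (Real.rpow_nonneg (by nlinarith [ht.2]) _))))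
  exact dissipationGauge_of_enstrophyClock hν hT hmax ha1 ha2 (le_max_right _ _) hr₂ hclock'

/-- **K11 + K9a · RZ ⟹ NA.** The enstrophy clock implies the crux NA `ConicalSkirtNoAnomaly` of the child route
`RootDecompOnsagerEdge` (verbatim ledger signature): RZ is a certified SUFFICIENT attack line for NA. -/
theorem noAnomaly_of_enstrophyClockedSkirt
    (hRZ : ∀ (ν T : ℝ), 0 < ν → 0 < T → ∀ (u : ℝ → EuclideanSpace ℝ (Fin 3) → EuclideanSpace ℝ (Fin 3)) (p : ℝ → EuclideanSpace ℝ (Fin 3) → ℝ), Literature.Analysis.FluidPDE.IsMaximalSmoothSolution ν 0 u p T → Literature.Analysis.FluidPDE.IsLerayHopfOn T ν 0 (u 0) u → Literature.Analysis.FluidPDE.HasRapidSpatialDecay (u 0) → Filter.Tendsto (fun t => MeasureTheory.eLpNorm (u t - u T) 2 MeasureTheory.volume) (nhdsWithin T (Set.Iio T)) (nhds 0) → ∀ (x₀ : EuclideanSpace ℝ (Fin 3)) (r : ℕ → ℝ) (a r₀ C J c η : ℝ), ((∀ k, 0 < r k) ∧ Filter.Tendsto r Filter.atTop (nhds 0)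 ∧ Filter.Tendsto (fun k => (r k)⁻¹ * ∫ x in Metric.ball x₀ (r k), ‖u T x‖ ^ 2) Filter.atTop Filter.atTop) → (∃ c : ℝ, 0 < c ∧ ∀ k, ∃ t ∈ Set.Ioo (T - r k ^ 2) T, c * (∫ x in Metric.ball x₀ (r k), ‖u T x‖ ^ 2) < ∫ x in Metric.ball x₀ (r k), ‖u t x - u T x‖ ^ 2) → 1 < a → a ≤ 3 / 2 → 0 < r₀ → 0 ≤ C → 0 ≤ J → 0 < c → 0 < η → (∀ ρ ∈ Set.Ioc 0 r₀, (∫⁻ x in Metric.ball x₀ ρ, ‖u T x‖ₑ ^ 2 ≤ ENNReal.ofReal (C * ρ ^ (3 - 2 * a))) ∧ ∀ s ∈ Set.Ioo (T - ρ ^ 2 / ν) T, ∫⁻ x in Metric.ball x₀ ρ, ‖u s x - u T x‖ₑ ^ 2 ≤ ENNReal.ofReal J * ∫⁻ x in Metric.ball x₀ ρ, ‖u T x‖ₑ ^ 2) → (∀ k : ℕ, ENNReal.ofReal (c * r k ^ (3 - 2 * a)) ≤ ∫⁻ x in Metric.ball x₀ (r k), ‖u T x‖ₑ ^ 2 ∧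 ∀ s ∈ Set.Ioo (T - r k ^ (1 + a) / ν) T, ENNReal.ofReal η * ∫⁻ x in Metric.ball x₀ (r k), ‖u T x‖ₑ ^ 2 ≤ ∫⁻ x in Metric.ball x₀ (r k), ‖u s x‖ₑ ^ 2) → ∃ (K r₂ : ℝ), 0 < r₂ ∧ ∀ ρ ∈ Set.Ioc 0 r₂, ∀ t ∈ Set.Ioo (T - r₂ ^ 2) T, ∫⁻ x in Metric.ball x₀ ρ, ENNReal.ofReal (Literature.Analysis.FluidPDE.frobeniusNormSq (fderiv ℝ (u t) x)) ≤ ENNReal.ofReal (K * min (ρ ^ 3 * (ν * (T - t)) ^ (-(2 : ℝ))) ((ν * (T - t)) ^ ((1 - 2 * a) / (1 + a))))) :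
    ∀ (ν T : ℝ), 0 < ν → 0 < T → ∀ (u : ℝ → EuclideanSpace ℝ (Fin 3) → EuclideanSpace ℝ (Fin 3)) (p : ℝ → EuclideanSpace ℝ (Fin 3) → ℝ), Literature.Analysis.FluidPDE.IsMaximalSmoothSolution ν 0 u p T → Literature.Analysis.FluidPDE.IsLerayHopfOn T ν 0 (u 0) u → Literature.Analysis.FluidPDE.HasRapidSpatialDecay (u 0) → Filter.Tendsto (fun t => MeasureTheory.eLpNorm (u t - u T) 2 MeasureTheory.volume) (nhdsWithin T (Set.Iio T)) (nhds 0) → ∀ (x₀ : EuclideanSpace ℝ (Fin 3)) (r : ℕ → ℝ) (a r₀ C J c η : ℝ), ((∀ k, 0 < r k) ∧ Filter.Tendsto r Filter.atTop (nhds 0) ∧ Filter.Tendsto (fun k => (r k)⁻¹ * ∫ x in Metric.ball x₀ (r k), ‖u T x‖ ^ 2) Filter.atTop Filter.atTop) → (∃ c : ℝ, 0 < c ∧ ∀ k, ∃ t ∈ Set.Ioo (T - r k ^ 2) T, c * (∫ x in Metric.ball x₀ (r k), ‖u T x‖ ^ 2) < ∫ x in Metric.ball x₀ (r k), ‖u t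 x - u T x‖ ^ 2) → 1 < a → a ≤ 3 / 2 → 0 < r₀ → 0 ≤ C → 0 ≤ J → 0 < c → 0 < η → (∀ ρ ∈ Set.Ioc 0 r₀, (∫⁻ x in Metric.ball x₀ ρ, ‖u T x‖ₑ ^ 2 ≤ ENNReal.ofReal (C * ρ ^ (3 - 2 * a))) ∧ ∀ s ∈ Set.Ioo (T - ρ ^ 2 / ν) T, ∫⁻ x in Metric.ball x₀ ρ, ‖u s x - u T x‖ₑ ^ 2 ≤ ENNReal.ofReal J * ∫⁻ x in Metric.ball x₀ ρ, ‖u T x‖ₑ ^ 2) → (∀ k : ℕ, ENNReal.ofReal (c * r k ^ (3 - 2 * a)) ≤ ∫⁻ x in Metric.ball x₀ (r k), ‖u T x‖ₑ ^ 2 ∧ ∀ s ∈ Set.Ioo (T - r k ^ (1 + a) / ν) T, ENNReal.ofReal η * ∫⁻ x in Metric.ball x₀ (r k), ‖u T x‖ₑ ^ 2 ≤ ∫⁻ x in Metric.ball x₀ (r k), ‖u s x‖ₑ ^ 2) → Filter.Tendsto (fun r' : ℝ => ENNReal.ofReal (r' ^ (2 * (a - 1))) * Literature.Analysis.FluidPDE.cknE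 r' (ν * T, x₀) (fun s y => fderiv ℝ (fun y => ν⁻¹ • u (s / ν) y) y)) (nhdsWithin 0 (Set.Ioi 0)) (nhds 0) :=
  noAnomaly_of_dissipationGauge (conicalSkirtDissipationGauge_of_enstrophyClockedSkirt hRZ)

end Summit.NavierStokesRegularity.NavierStokesRegularity.Theorems.RootDecompStaticSkirtEnstrophyClock

end
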